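import Summits.QuantumFields.YangMills.Theorems.FluctuationComparisonRegPrIntLS2BetaRelativeGaugeCovariance
import Summits.QuantumFields.YangMills.Theorems.FluctuationComparisonRegPrIntLS2BetaTreeCombBondStep
import HarnessLib

/-!
# S2β · Q11d — THE TOP-STAGE INTRA-BLOCK LADDER FOR THE TWO TOWERS: (4b)'s tree-comb agreement ∘ Q11b-lattice ∘ Q11c
# (any torus in standing range, any `GaugeGroup`, any averaging family; the stage pair AND the plain pair)

Cell `ym3-torus` (rung R3 = continuum `SU(2)` YM₃ on T³ at fixed lattice data — NOT d = 4, NOT infinite volume, NOT a mass gap, NOT Clay).  Width seat `ym3-torus-px5` (gen 23);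
crux `stmt-QuantumFields-20520`, LINE g18-1 S2β; (TOP-LAD′)'s `c₃` row, intra-block part (B) (px20 (ii), px17 FILE 3b∕READ′).  THE JUNCTION, BY `exact`: (4b) ✓p828327
`stageChord_treeComb_eq_one_of_top` says that at the TOP stage (`htop`: the two towers' level-`(j+1)` stage fields coincide — fibre mates) the two STAGE fields
`U′_j := g j • iter j U` and `U₁′_j := g₀ j • iter j U₁` AGREE on every tree-comb bond of every block; Q11b-lattice ✓p831150 turns tree-comb agreement + relative plaquettes `≤ ρ` on a
block into «every intra-block chord `≤ (Σ_{ν<e}|(y − emb B)_ν|)·ρ`»; Q11c ✓p831424 moves the statement across a common gauge.  Hence: §1 the STAGE pair's intra-block chords at the top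
stage are `≤ (Σ_{ν<e}|(y − emb B)_ν|)·ρ ≤ e·((L−1)∕2)·ρ` (ρ = the stage pair's relative-plaquette sup on the block — equal to the plain pair's by Q11c when the gauges agree); §2 under the
`AxStage` consequence `g₀ j • iter j U₁ = g j • iter j U₀` (same gauge on both sides) the PLAIN descended pair `(iter j U, iter j U₀)` obeys the same bound with ITS OWN relative plaquettes —
the reading of px17 g22's `a 0`.  `--kind proof --supports stmt-QuantumFields-20520 --as helper`, count-neutral, DEFINITION-FREE (0 `def`, 0 `instance`, 0 `notation`, 0 `sorry`, default
heartbeats); generic `P : Params`, ANY `GaugeGroup G`, ANY `av : ∀ i, Averaging P i G`, abstract `lift`, `g`, `g₀` under (4b)'s (T4) readings `hT4`, `hT4'`.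

WHAT IS PROVED (sorry-free).
* §1 `stage_agree_of_treeComb_top` ((4b) in Q11b-lattice's `htree` shape, per block), ★★★`dist1_stageChord_le_of_intraBlock_top` (`U⁻¹·W` reading), ★`dist1_stageChord_le_of_intraBlock_top'`
  (`W·U⁻¹` reading, px16's stage chord), ★`dist1_stageChord_le_of_intraBlock_top_crude` (`≤ (e·((L−1)∕2))·ρ`).
* §2 ★★★`dist1_plainChord_le_of_intraBlock_top` — with `hsame : g₀ j • iter j U₁ = g j • iter j U₀`: **`dist1 ((iter j U₀ ⟨y,e⟩)⁻¹·iter j U ⟨y,e⟩) ≤ (Σ_{ν<e}|(y − emb B)_ν|)·ρ`** for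
  `ρ` bounding the PLAIN pair's relative plaquettes on `B`.

HONEST SCOPE.  A junction of landed lemmas; nothing of Bałaban's analysis is asserted or proved; `hsame` (one rewrite inside the `AxStage` binder: intertwining + `U₀ = (g0⁻¹·g₀0)•U₁`),
`htop` (from the fibre condition + `g (K−J) = g₀ (K−J) = 1`), the face-crossing bonds, the square∕`Σ_B`∕READ′ aggregation of (TOP-LAD′) are NOT here; (TOP-LAD)∕(LIFT-LAD′)∕(SCT₁₂₃)∕(ST′)∕
(ST), LOC's discharge, «MULT♭-ax»∕«CRIT-ax», (D-stage), h3, GAP♯∘ (`stub_uniformFibreGapOrbit`, registry 3732b7df UNTOUCHED, 0∕5), S2β, the five registered stubs, 20520, 19936, 19200,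
`YM3TorusSU2` NOT proved; no summit statement is proved by a helper; rung R3 — NOT d = 4, NOT infinite volume, NOT a mass gap, NOT Clay; the Yang–Mills mass gap is NOT proved.

References: T. Bałaban, CMP **98** (1985) 17–51 [Balaban1985Averaging] ((19) p.21, p.24, (58) p.27); CMP **102** (1985) 277–309 [Balaban1985RegularSpaces] ((1.19) p.79);
CMP **122** (1989) 355–392 [Balaban1989LargeFieldII] (p.382).
-/

set_option autoImplicit false

namespace Summit.QuantumFields.YangMills.Theorems.FluctuationComparisonRegPrIntLS2BetaTopLadderStage

open Literature.MathematicalPhysics.QuantumFieldTheory.Balaban1983to89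
open Literature.MathematicalPhysics.QuantumFieldTheory.Balaban1983to89.T4Continuum
open Literature.MathematicalPhysics.QuantumFieldTheory.Balaban1983to89.BlockAveraging
open B10Eq27TorusAxialLog (rel axialT)
open Summit.QuantumFields.YangMills.Theorems.FluctuationComparisonRegPrIntLS2BetaRelativeStokes (dist1_mul_inv_eq_rel)
open Summit.QuantumFields.YangMills.Theorems.FluctuationComparisonRegPrIntLS2BetaTreeCombBondStep (stageChord_treeComb_eq_one_of_top)
open Summit.QuantumFields.YangMills.Theorems.FluctuationComparisonRegPrIntLS2BetaTopLadderIntraBlock (dist1_chord_le_of_intraBlock dist1_chord_le_of_intraBlock')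
open Summit.QuantumFields.YangMills.Theorems.FluctuationComparisonRegPrIntLS2BetaRelativeGaugeCovariance (dist1_chord_le_of_intraBlock_gaugeAct)

variable {P : Params} {G : Type*} [GaugeGroup G]

/-! ## §1 The stage pair at the top stage -/

/-- (4b) ✓`stageChord_treeComb_eq_one_of_top` in the per-block `htree` shape of Q11b-lattice: at the top stage the two stage fields agree on every tree-comb bond of the block `B`.
[cite: Balaban1985Averaging, (58) p.27; Balaban1985RegularSpaces, (1.19) p.79] -/
theorem stage_agree_of_treeComb_top (av : ∀ i, Averaging P i G) {j : ℕ} (hj : j + 1 ≤ P.m + P.K)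
    (lift : (i : ℕ) → GaugeField P (i + 1) G → GaugeField P i G) (g g₀ : (i : ℕ) → Site P i → G) (U U₁ : GaugeField P 0 G)
    (hT4 : ∀ x, axialT (GaugeField.gaugeAct (g j) (Averaging.iter av j U)) (emb (blockOf x)) x =
      axialT (lift j (GaugeField.gaugeAct (g (j + 1)) (Averaging.iter av (j + 1) U))) (emb (blockOf x)) x)
    (hT4' : ∀ x, axialT (GaugeField.gaugeAct (g₀ j) (Averaging.iter av j U₁)) (emb (blockOf x)) x =
      axialT (lift j (GaugeField.gaugeAct (g₀ (j + 1)) (Averaging.iter av (j + 1) U₁))) (emb (blockOf x)) x)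
    (htop : GaugeField.gaugeAct (g (j + 1)) (Averaging.iter av (j + 1) U) = GaugeField.gaugeAct (g₀ (j + 1)) (Averaging.iter av (j + 1) U₁))
    (B : Site P (j + 1)) :
    ∀ (x : Site P j) (μ : Fin P.d), blockOf x = B → blockOf (x.shift μ) = B → (∀ ν, ν < μ → rel (emb B) x ν = 0) →
      GaugeField.gaugeAct (g j) (Averaging.iter av j U) ⟨x, μ⟩ = GaugeField.gaugeAct (g₀ j) (Averaging.iter av j U₁) ⟨x, μ⟩ := by
  intro x μ hx hxμ hlo
  refine stageChord_treeComb_eq_one_of_top av hj lift g g₀ U U₁ hT4 hT4' htop x μ (by rw [hxμ, hx]) (fun ν hν => ?_)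
  rw [hx]
  exact hlo ν hν

/-- ★★★ **TOP STAGE, STAGE PAIR: EVERY INTRA-BLOCK CHORD IS A PURE LADDER.**  If at the top stage every plaquette of the stage pair `(U′_j, U₁′_j)` with source in the block `B` has
relative size `≤ ρ`, then every bond `⟨y, e⟩` with `y, y + e ∈ B` obeys `dist1 (U₁′_j⟨y,e⟩⁻¹·U′_j⟨y,e⟩) ≤ (Σ_{ν<e} |(y − emb B)_ν|)·ρ`.
[cite: Balaban1989LargeFieldII, p.382; Balaban1985Averaging, (19) p.21, (58) p.27] -/
theorem dist1_stageChord_le_of_intraBlock_top (av : ∀ i, Averaging P i G) {j : ℕ} (hj : j + 1 ≤ P.m + P.K)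
    (lift : (i : ℕ) → GaugeField P (i + 1) G → GaugeField P i G) (g g₀ : (i : ℕ) → Site P i → G) (U U₁ : GaugeField P 0 G)
    (hT4 : ∀ x, axialT (GaugeField.gaugeAct (g j) (Averaging.iter av j U)) (emb (blockOf x)) x =
      axialT (lift j (GaugeField.gaugeAct (g (j + 1)) (Averaging.iter av (j + 1) U))) (emb (blockOf x)) x)
    (hT4' : ∀ x, axialT (GaugeField.gaugeAct (g₀ j) (Averaging.iter av j U₁)) (emb (blockOf x)) x =
      axialT (lift j (GaugeField.gaugeAct (g₀ (j + 1)) (Averaging.iter av (j + 1) U₁))) (emb (blockOf x)) x)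
    (htop : GaugeField.gaugeAct (g (j + 1)) (Averaging.iter av (j + 1) U) = GaugeField.gaugeAct (g₀ (j + 1)) (Averaging.iter av (j + 1) U₁))
    (B : Site P (j + 1)) {ρ : ℝ} (hρ0 : 0 ≤ ρ)
    (hρ : ∀ q : Plaq P j, blockOf q.src = B →
      dist1 ((GaugeField.plaqHol (GaugeField.gaugeAct (g₀ j) (Averaging.iter av j U₁)) q)⁻¹ *
        GaugeField.plaqHol (GaugeField.gaugeAct (g j) (Averaging.iter av j U)) q) ≤ ρ)
    (y : Site P j) (e' : Fin P.d) (hy : blockOf y = B) (hye : blockOf (y.shift e') = B) :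
    dist1 ((GaugeField.gaugeAct (g₀ j) (Averaging.iter av j U₁) ⟨y, e'⟩)⁻¹ * GaugeField.gaugeAct (g j) (Averaging.iter av j U) ⟨y, e'⟩) ≤
      (∑ ν ∈ Finset.univ.filter (fun ν => ν < e'), (rel (emb B) y ν).natAbs) * ρ :=
  dist1_chord_le_of_intraBlock hj _ _ B (stage_agree_of_treeComb_top av hj lift g g₀ U U₁ hT4 hT4' htop B) hρ0 hρ y e' hy hye

/-- ★ The same in the `W·U⁻¹` reading of the stage chord (px16's `stageChord`): `dist1 (U′_j⟨y,e⟩·U₁′_j⟨y,e⟩⁻¹) ≤ (Σ_{ν<e} |(y − emb B)_ν|)·ρ`.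
[cite: Balaban1989LargeFieldII, p.382; Balaban1985Averaging, (58) p.27] -/
theorem dist1_stageChord_le_of_intraBlock_top' (av : ∀ i, Averaging P i G) {j : ℕ} (hj : j + 1 ≤ P.m + P.K)
    (lift : (i : ℕ) → GaugeField P (i + 1) G → GaugeField P i G) (g g₀ : (i : ℕ) → Site P i → G) (U U₁ : GaugeField P 0 G)
    (hT4 : ∀ x, axialT (GaugeField.gaugeAct (g j) (Averaging.iter av j U)) (emb (blockOf x)) x =
      axialT (lift j (GaugeField.gaugeAct (g (j + 1)) (Averaging.iter av (j + 1) U))) (emb (blockOf x)) x)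
    (hT4' : ∀ x, axialT (GaugeField.gaugeAct (g₀ j) (Averaging.iter av j U₁)) (emb (blockOf x)) x =
      axialT (lift j (GaugeField.gaugeAct (g₀ (j + 1)) (Averaging.iter av (j + 1) U₁))) (emb (blockOf x)) x)
    (htop : GaugeField.gaugeAct (g (j + 1)) (Averaging.iter av (j + 1) U) = GaugeField.gaugeAct (g₀ (j + 1)) (Averaging.iter av (j + 1) U₁))
    (B : Site P (j + 1)) {ρ : ℝ} (hρ0 : 0 ≤ ρ)
    (hρ : ∀ q : Plaq P j, blockOf q.src = B →
      dist1 ((GaugeField.plaqHol (GaugeField.gaugeAct (g₀ j) (Averaging.iter av j U₁)) q)⁻¹ *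
        GaugeField.plaqHol (GaugeField.gaugeAct (g j) (Averaging.iter av j U)) q) ≤ ρ)
    (y : Site P j) (e' : Fin P.d) (hy : blockOf y = B) (hye : blockOf (y.shift e') = B) :
    dist1 (GaugeField.gaugeAct (g j) (Averaging.iter av j U) ⟨y, e'⟩ * (GaugeField.gaugeAct (g₀ j) (Averaging.iter av j U₁) ⟨y, e'⟩)⁻¹) ≤
      (∑ ν ∈ Finset.univ.filter (fun ν => ν < e'), (rel (emb B) y ν).natAbs) * ρ := by
  rw [dist1_mul_inv_eq_rel]
  exact dist1_stageChord_le_of_intraBlock_top av hj lift g g₀ U U₁ hT4 hT4' htop B hρ0 hρ y e' hy hye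

/-- ★ The crude form: `≤ (e·((L−1)∕2))·ρ`. [cite: Balaban1989LargeFieldII, p.382; Balaban1987RG1, (0.3) p.252] -/
theorem dist1_stageChord_le_of_intraBlock_top_crude (av : ∀ i, Averaging P i G) {j : ℕ} (hj : j + 1 ≤ P.m + P.K)
    (lift : (i : ℕ) → GaugeField P (i + 1) G → GaugeField P i G) (g g₀ : (i : ℕ) → Site P i → G) (U U₁ : GaugeField P 0 G)
    (hT4 : ∀ x, axialT (GaugeField.gaugeAct (g j) (Averaging.iter av j U)) (emb (blockOf x)) x =
      axialT (lift j (GaugeField.gaugeAct (g (j + 1)) (Averaging.iter av (j + 1) U))) (emb (blockOf x)) x)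
    (hT4' : ∀ x, axialT (GaugeField.gaugeAct (g₀ j) (Averaging.iter av j U₁)) (emb (blockOf x)) x =
      axialT (lift j (GaugeField.gaugeAct (g₀ (j + 1)) (Averaging.iter av (j + 1) U₁))) (emb (blockOf x)) x)
    (htop : GaugeField.gaugeAct (g (j + 1)) (Averaging.iter av (j + 1) U) = GaugeField.gaugeAct (g₀ (j + 1)) (Averaging.iter av (j + 1) U₁))
    (B : Site P (j + 1)) {ρ : ℝ} (hρ0 : 0 ≤ ρ)
    (hρ : ∀ q : Plaq P j, blockOf q.src = B →
      dist1 ((GaugeField.plaqHol (GaugeField.gaugeAct (g₀ j) (Averaging.iter av j U₁)) q)⁻¹ *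
        GaugeField.plaqHol (GaugeField.gaugeAct (g j) (Averaging.iter av j U)) q) ≤ ρ)
    (y : Site P j) (e' : Fin P.d) (hy : blockOf y = B) (hye : blockOf (y.shift e') = B) :
    dist1 ((GaugeField.gaugeAct (g₀ j) (Averaging.iter av j U₁) ⟨y, e'⟩)⁻¹ * GaugeField.gaugeAct (g j) (Averaging.iter av j U) ⟨y, e'⟩) ≤
      ((e'.val * ((P.L - 1) / 2) : ℕ) : ℝ) * ρ :=
  dist1_chord_le_of_intraBlock' hj _ _ B (stage_agree_of_treeComb_top av hj lift g g₀ U U₁ hT4 hT4' htop B) hρ0 hρ y e' hy hye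

/-! ## §2 The plain descended pair under the common-gauge identity -/

/-- ★★★ **TOP STAGE, PLAIN PAIR.**  If moreover the second tower's stage field is the first tower's gauge applied to `U₀`'s descended field (`hsame : g₀ j • iter j U₁ = g j • iter j U₀`, the
`AxStage` consequence), then the PLAIN descended pair `(iter j U, iter j U₀)` obeys, with `ρ` bounding ITS relative plaquettes on the block `B`:
`dist1 ((iter j U₀ ⟨y,e⟩)⁻¹·iter j U ⟨y,e⟩) ≤ (Σ_{ν<e} |(y − emb B)_ν|)·ρ` for every bond with `y, y + e ∈ B` — px17 g22's `a 0` reading of the intra-block chords.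
[cite: Balaban1989LargeFieldII, p.382; Balaban1985Averaging, (8)-(12) p.18-19, (58) p.27] -/
theorem dist1_plainChord_le_of_intraBlock_top (av : ∀ i, Averaging P i G) {j : ℕ} (hj : j + 1 ≤ P.m + P.K)
    (lift : (i : ℕ) → GaugeField P (i + 1) G → GaugeField P i G) (g g₀ : (i : ℕ) → Site P i → G) (U U₁ U₀ : GaugeField P 0 G)
    (hT4 : ∀ x, axialT (GaugeField.gaugeAct (g j) (Averaging.iter av j U)) (emb (blockOf x)) x =
      axialT (lift j (GaugeField.gaugeAct (g (j + 1)) (Averaging.iter av (j + 1) U))) (emb (blockOf x)) x)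
    (hT4' : ∀ x, axialT (GaugeField.gaugeAct (g₀ j) (Averaging.iter av j U₁)) (emb (blockOf x)) x =
      axialT (lift j (GaugeField.gaugeAct (g₀ (j + 1)) (Averaging.iter av (j + 1) U₁))) (emb (blockOf x)) x)
    (htop : GaugeField.gaugeAct (g (j + 1)) (Averaging.iter av (j + 1) U) = GaugeField.gaugeAct (g₀ (j + 1)) (Averaging.iter av (j + 1) U₁))
    (hsame : GaugeField.gaugeAct (g₀ j) (Averaging.iter av j U₁) = GaugeField.gaugeAct (g j) (Averaging.iter av j U₀))
    (B : Site P (j + 1)) {ρ : ℝ} (hρ0 : 0 ≤ ρ)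
    (hρ : ∀ q : Plaq P j, blockOf q.src = B →
      dist1 ((GaugeField.plaqHol (Averaging.iter av j U₀) q)⁻¹ * GaugeField.plaqHol (Averaging.iter av j U) q) ≤ ρ)
    (y : Site P j) (e' : Fin P.d) (hy : blockOf y = B) (hye : blockOf (y.shift e') = B) :
    dist1 ((Averaging.iter av j U₀ ⟨y, e'⟩)⁻¹ * Averaging.iter av j U ⟨y, e'⟩) ≤
      (∑ ν ∈ Finset.univ.filter (fun ν => ν < e'), (rel (emb B) y ν).natAbs) * ρ := by
  have htree := stage_agree_of_treeComb_top av hj lift g g₀ U U₁ hT4 hT4' htop B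
  rw [hsame] at htree
  exact dist1_chord_le_of_intraBlock_gaugeAct hj (g j) (Averaging.iter av j U) (Averaging.iter av j U₀) B htree hρ0 hρ y e' hy hye

end Summit.QuantumFields.YangMills.Theorems.FluctuationComparisonRegPrIntLS2BetaTopLadderStage
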